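import Summits.BirchSwinnertonDyer.BirchSwinnertonDyer.Theorems.UniversalToricDescentRoadFFCpIntMemberTower
import Summits.BirchSwinnertonDyer.BirchSwinnertonDyer.Theorems.UniversalToricDescentSelfDualMemberCongruenceOdd
import HarnessLib

/-!
# Route `UniversalToricDescent`, ♭B column (♭B′ `TwinWanFrameAtThreeMultTresT` 27401; K1-at-3 27934 → K1♯†), line `membertower`:
# the Road-FF descent at the 3-multiplicative twin from Hida members read on their SELF-DUAL modules `A^†_{g_m}`
# (weights `k_m ≡ 2 (mod 2(p−1)p^{m−1})`), frames in `𝓞_{ℂ_p}⟦T⟧`, PRINTED two-sided congruence, RATIONAL member inclusion of ANY exponent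

Width seat bsd-wall-utd-p2-w2 g9 (2026-08-28), brick (B2) of the kernel† `(5)†: 20711 → 22593† → K1♯† → ♭B′` (pen bsd-wall-pss3x sequence
T0→T3 of 18:50:09Z; lead bsd-wall-utd-p2 g18 holds the core); `--supports stmt-BirchSwinnertonDyer-27401 --as helper`; Theses-free.

## What this file proves

p633686 (`UniversalToricDescentRoadFFCpIntMemberTower`, lead utd-p2 g13) §2 ∕ §3 RE-RUN with the member data read on the erratum's
SELF-DUAL module: in the member package `hmem`, per level `m ≥ 1`, the Hida member `D` now comes WITH the weight clause
`2(p−1)p^{m−1} ∣ k_m − 2` (print's free choice of `k_m` in its residue class, [Skinner2016PacificMC] §2.6; it is what makes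
`A^†_{g_m}[p^m] ≅ (E[p^∞] ⊗ 𝒪_m)[p^m]`, bsd-stepL's (b†) p658384), and the rational inclusion (K1′) and its torsion premise are stated for
`XBig κ (D.Δ.selfDualCofreeRepOver K) 𝔭bar Σ` — the Greenberg Selmer dual of `A^†_{g_m} = V^†/T^†`, `T^† = T_{g_m} ⊗ ε^{1−k_m/2}`
([Castella2018Erratum] §2 p. 2: «the self-dual Tate twist … [Nek92, § 3] … `A_g := V_g/T_g`»; vet bsd-vet-utdR2 g3/g4 RETURN of
K1-at-3, pen PEN-RULING-27934-v1) — instead of the untwisted `D.Δ.cofreeRepOver K` (faithful only at `k = 2`).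

* §2† `P2.RoadFF.exists_map_span_C_pow_mul_fittingIdeal_le_of_cpIntMemberTower_selfDual_odd` — at any odd `p ≥ 3`:
  `∃ t, (C(p)^t·Fitt₀_Λ(X^Σ_ac(E; slot 𝔭bar)))·R₀⟦T⟧ ⊆ (L·P_Σ)`. The proof is p633686's VERBATIM except at the TWO places where the member
  module is touched: finite generation of `X^Σ_ac(A^†_{g_m})` ((unr)† `SelfDualTwist.selfDualCofreeRepOver_localMap_inr_apply_eq_self`,
  bsd-stepL imc-p1 g24; the `Cofree` torsion∕divisibility lemmas are generic in the framed representation) and the member congruence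
  `e_m^†` (`RoadFFMember.SelfDual.nonempty_memberCongruence_odd_of_facts`, file `UniversalToricDescentSelfDualMemberCongruenceOdd`, fed the
  weight clause); unit congruence, saturation, purity descent and the per-level limit never see `ρ`.
* §3† `twin_exists_forall_C_pow_mul_mem_span_of_cpIntMemberTower_selfDual_of_isTorsion` — at the 3-multiplicative twin: ♭B′'s `∃ k`-clause
  under torsion from the self-dual member package (§2† + p613967 + p612782's twisted recombination, as in p633686 §3).

HONEST FRAMING: theorems only (no definition, no named fact, no instance, no `sorry`); CONDITIONAL on Shapiro `hSh` (PUBLISHED), the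
self-dual members-with-frames package and the rational member inclusion (RESEARCH, port-shaped: the supply 22593† and the crux K1♯† of the
pen's sequence), torsion and (dec); nothing is booked; no item is closed; BSD is proved for no curve.

References: [Castella2018Erratum] §2 (p. 2), proof of Thm. 1.1 (a)(b)(c) (p. 4); [Skinner2016PacificMC] §2.6, §3.1 (p. 192);
[Castella2020JIMJ] Def. 1.3, Thm. 1.4, Thm. 2.11; [Hsieh2014] Thm. B; [JetchevSkinnerWan2017] §5.1; [Lam1999] (4.92)–(4.93).
-/

set_option autoImplicit false

noncomputable section

open scoped TensorProduct Classical

open CategoryTheory PowerSeries NumberField IsDedekindDomain Field WeierstrassCurve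
open Literature.NumberTheory.GaloisRepresentations Literature.NumberTheory.EllipticCurves
  Literature.NumberTheory.EllipticCurves.BigGaloisRep Literature.NumberTheory.EllipticCurves.GreenbergSelmer
  Literature.NumberTheory.EllipticCurves.Skinner2016 Literature.NumberTheory.EllipticCurves.Rank1Residual
  Literature.NumberTheory.EllipticCurves.Rank1Residual.Typed Literature.NumberTheory.EllipticCurves.ModularForms
  Literature.NumberTheory.EllipticCurves.Castella2018 Literature.RingTheory.FittingIdeal
  Literature.NumberTheory.EllipticCurves.Module
open Summit.BirchSwinnertonDyer.Rank1Residual.X11b.Halves Summit.BirchSwinnertonDyer.Rank1Residual.X11b.AcSelmer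
  Summit.BirchSwinnertonDyer.Rank1Residual.X2

namespace Summit.BirchSwinnertonDyer.Rank1Residual.X11b

/-! ### §2 The Road-FF kernel at odd `p` from members read in `𝓞_{ℂ_p}⟦T⟧` -/

open RoadFFMember Summit.BirchSwinnertonDyer.BirchSwinnertonDyer.Theorems

set_option maxHeartbeats 3200000 in
/-- **ROAD FF DESCENT KERNEL AT ANY ODD PRIME FROM HIDA MEMBERS READ ON THEIR SELF-DUAL MODULES IN `𝓞_{ℂ_p}⟦T⟧` (rational
inclusions of ANY exponent, PRINTED two-sided congruence, weights `k_m ≡ 2 (mod 2(p−1)p^{m−1})`).** For a globally minimal `E/ℚ`,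
`p ≥ 3` with `E[p]` irreducible and `p ∥ N`, `K` imaginary quadratic with `p` split, the X-slot `𝔭bar ∋ p`, (dec), `L ∈ R₀⟦T⟧` with a
unit coefficient, and for every `m ≥ 1` a Hida member `g_m` WITH `2(p−1)p^{m−1} ∣ k_m − 2` and SOME `Q_m ∈ 𝓞_{ℂ_p}⟦T⟧` such that (K1′†)
in the receptacle `𝓞_{ℂ_p}` «torsion → `(p^e)·Ch(X^Σ_ac(A^†_{g_m}))·𝓞_{ℂ_p}⟦T⟧ ⊆ (Q_m)` for SOME `e`» — `X^Σ_ac(A^†_{g_m}) =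
XBig κ (D.Δ.selfDualCofreeRepOver K) 𝔭bar Σ`, the erratum's module — and (c) `(Q_m) + (p^m) = (L·P_Σ) + (p^m)`: then
`(C(p)^t·Fitt₀_Λ(X^Σ_ac(E; slot 𝔭bar)))·R₀⟦T⟧ ⊆ (L·P_Σ)` for SOME `t`. Proof = p633686's
`P2.RoadFF.exists_map_span_C_pow_mul_fittingIdeal_le_of_cpIntMemberTower_odd` VERBATIM except: finite generation of
`X^Σ_ac(A^†_{g_m})` through (unr)† `SelfDualTwist.selfDualCofreeRepOver_localMap_inr_apply_eq_self`, and the member congruence `e_m^†`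
through `RoadFFMember.SelfDual.nonempty_memberCongruence_odd_of_facts` (fed the weight clause). CONDITIONAL on Shapiro `hSh` (PUBLISHED)
and the displayed member data (RESEARCH, port-shaped); nothing is booked; BSD is proved for no curve.
[cite: Castella2018Erratum, §2 (p. 2), (b), (c), Lemma 2.1, (2.5) and proof of Thm. 1.1 (pp. 2–4)]
[cite: Skinner2016PacificMC, §2.3 (p. 179), §2.6 (2-6-1), §3.1 (p. 192)] [cite: SkinnerUrban2014, Prop. 3.2.3, Lemma 3.1.9]
[cite: Hsieh2014, Thm. B (the unit coefficient of `L`)] [cite: Lam1999, (4.92)–(4.93) (purity)] -/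
theorem P2.RoadFF.exists_map_span_C_pow_mul_fittingIdeal_le_of_cpIntMemberTower_selfDual_odd
    (hSh : SkinnerUrban2014.prop323_XAc_equiv_XBigDecomp)
    (W : WeierstrassCurve ℚ) [W.IsElliptic] [W.IsGloballyMinimal] (p : ℕ) [Fact p.Prime] (hp : 3 ≤ p)
    (K : Type) [Field K] [NumberField K] (hK : IsImaginaryQuadratic K) (hirr : Irr W p) (hmult : Mult W p)
    (hsp : SplitsIn K p) (hiv : ∀ Q : (W.baseChange ℚ_[p]).toAffine.Point, p • Q = 0 → Q = 0)
    (κ : ZpExtension K p) (hκ : κ.IsAnticyclotomic) (γ : Field.absoluteGaloisGroup K) [Fact (κ.IsTopGenerator γ)]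
    (𝔭bar : HeightOneSpectrum (𝓞 K)) (h𝔭bar : ((p : ℕ) : 𝓞 K) ∈ 𝔭bar.asIdeal)
    (L : UnrSeries p) (hμL : ∃ i : ℕ, IsUnit (PowerSeries.coeff i L))
    (hmem : ∀ m : ℕ, 1 ≤ m →
      ∃ (D : Skinner2016.HidaCongruentMember W p m) (Qm : PowerSeries 𝓞_ℂ_[p]),
        (2 * ((p : ℤ) - 1) * (p : ℤ) ^ (m - 1)) ∣ D.k - 2 ∧
        (∀ [TopologicalSpace (PowerSeries (padicCoeffIntegers D.ι))]
          [ContinuousSMul (PowerSeries (padicCoeffIntegers D.ι))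
            (BigRepModule (padicCoeffIntegers D.ι) p (Cofree D.Δ.selfDualRep (padicCoeffField D.ι)))],
          ∀ (b : padicCoeffIntegers D.ι →+* 𝓞_ℂ_[p]),
            (∀ x, ((b x : 𝓞_ℂ_[p]) : ℂ_[p]) = algebraMap (PadicAlgCl p) ℂ_[p] (padicCoeffIntegers.toPadicAlgCl D.ι x)) →
            Module.IsTorsion (PowerSeries (padicCoeffIntegers D.ι))
                (XBig κ (D.Δ.selfDualCofreeRepOver K) 𝔭bar (↑(W.sigmaPlacesFinset p K))) →
              ∃ e : ℕ, Ideal.span {(C ((p : ℕ) : 𝓞_ℂ_[p]) : PowerSeries 𝓞_ℂ_[p]) ^ e} *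
                  (XBig.charIdeal κ (D.Δ.selfDualCofreeRepOver K) 𝔭bar (↑(W.sigmaPlacesFinset p K))).map (PowerSeries.map b) ≤
                Ideal.span {Qm}) ∧
        Ideal.span {Qm} ⊔ Ideal.span {(C (((p : ℕ) : 𝓞_ℂ_[p]) ^ m) : PowerSeries 𝓞_ℂ_[p])} =
          Ideal.span {PowerSeries.map (R1.unrToCpInt p) (L * PowerSeries.map (toUnr p) (W.sigmaEulerElement p K κ))} ⊔
            Ideal.span {(C (((p : ℕ) : 𝓞_ℂ_[p]) ^ m) : PowerSeries 𝓞_ℂ_[p])}) :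
    ∃ t : ℕ, (Ideal.span {(PowerSeries.C (p : ℤ_[p]) : IwasawaAlgebra p) ^ t} *
        Module.fittingIdeal (IwasawaAlgebra p)
          (AcSelmer.XAc (W.baseChange K) p κ 𝔭bar
            (↑(W.sigmaPlacesFinset p K) : Set (HeightOneSpectrum (𝓞 K))) γ) 0).map (PowerSeries.map (toUnr p)) ≤
      Ideal.span {L * PowerSeries.map (toUnr p) (W.sigmaEulerElement p K κ)} := by
  -- ### elementary consequences of the binders
  have hpN : p ∣ W.conductorNorm ℤ := dvd_conductorNorm_of_mult hmult
  have hN0 : W.conductorNorm ℤ ≠ 0 := (W.conductorNorm_pos_holds).ne'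
  have hpM : ¬ p ∣ W.conductorNorm ℤ / p := by
    have hfac := W.factorization_conductorNorm_eq_one_of_hasMultiplicativeReductionAtPrime p hmult
    intro h
    have h2 : p ^ 2 ∣ W.conductorNorm ℤ := by
      rw [pow_two]
      exact Nat.mul_dvd_of_dvd_div hpN h
    have := ((Fact.out : p.Prime).pow_dvd_iff_le_factorization hN0).mp h2
    omega
  have hMpos : 0 < W.conductorNorm ℤ / p :=
    Nat.div_pos (Nat.le_of_dvd (Nat.pos_of_ne_zero hN0) hpN) (Fact.out : p.Prime).pos
  haveI : NeZero (W.conductorNorm ℤ / p) := ⟨hMpos.ne'⟩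
  have hHp : SatisfiesHeegnerHypothesis p K := satisfiesHeegnerHypothesis_of_splitsIn Fact.out hsp
  -- ### `Σ`
  have hSfin : (↑(W.sigmaPlacesFinset p K) : Set (HeightOneSpectrum (𝓞 K))).Finite :=
    (W.sigmaPlacesFinset p K).finite_toSet
  have hSp : ∀ w ∈ (↑(W.sigmaPlacesFinset p K) : Set (HeightOneSpectrum (𝓞 K))),
      ((p : ℕ) : 𝓞 K) ∉ w.asIdeal :=
    fun w hw => W.forall_mem_sigmaPlacesFinset_not_mem p K w (Finset.mem_coe.1 hw)
  have hS : ∀ w : HeightOneSpectrum (𝓞 K), w ∉ (↑(W.sigmaPlacesFinset p K) : Set (HeightOneSpectrum (𝓞 K))) →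
      ((p : ℕ) : 𝓞 K) ∉ w.asIdeal → (W.baseChange K).HasGoodReductionAt w := by
    intro w hw hwp
    rw [WeierstrassCurve.coe_sigmaPlacesFinset] at hw
    exact WeierstrassCurve.hasGoodReductionAt_baseChange_of_not_mem_sigmaPlaces hw hwp
  have hSM : ∀ w : HeightOneSpectrum (𝓞 K), w ∉ (↑(W.sigmaPlacesFinset p K) : Set (HeightOneSpectrum (𝓞 K))) →
      ((W.conductorNorm ℤ / p : ℕ) : 𝓞 K) ∉ w.asIdeal := by
    intro w hw hM'
    rw [WeierstrassCurve.coe_sigmaPlacesFinset] at hw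
    exact hw (WeierstrassCurve.mem_sigmaPlaces_of_tameLevel_mem hpN hpM hM')
  -- ### `K_{𝔭bar} → ℚ_p`
  obtain ⟨heb, hfb⟩ := degreeOne_of_splitsIn hK.1 hsp h𝔭bar
  obtain ⟨φ⟩ := AcSelmer.exists_ringHom_adicCompletion_padic_of_degreeOne p 𝔭bar h𝔭bar heb hfb
  -- ### a member with its `Q_m` at every level `max m 1`
  choose Dm Qm hDm using fun m : ℕ => hmem (max m 1) (le_max_right m 1)
  -- ### topologies and coefficient-ring instances
  letI : TopologicalSpace (IwasawaAlgebra p) := ⊥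
  haveI : DiscreteTopology (IwasawaAlgebra p) := ⟨rfl⟩
  letI τ : ∀ m : ℕ, TopologicalSpace (PowerSeries (padicCoeffIntegers (Dm m).ι)) := fun _ => ⊥
  haveI : ∀ m : ℕ, DiscreteTopology (PowerSeries (padicCoeffIntegers (Dm m).ι)) := fun _ => ⟨rfl⟩
  haveI : ∀ m : ℕ, IsPrincipalIdealRing (padicCoeffIntegers (Dm m).ι) := fun m =>
    (Dm m).isPrincipalIdealRing_coeffRing
  -- ### the receptacle `𝓞_{ℂ_p}⟦T⟧`: the maps `b_m : 𝒪_m → 𝓞_{ℂ_p}`, the algebra structure over `R₀⟦T⟧`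
  have hb0 : ∀ m : ℕ, ∃ b : padicCoeffIntegers (Dm m).ι →+* 𝓞_ℂ_[p],
      ∀ x, ((b x : 𝓞_ℂ_[p]) : ℂ_[p]) = algebraMap (PadicAlgCl p) ℂ_[p] (padicCoeffIntegers.toPadicAlgCl (Dm m).ι x) :=
    fun m => exists_ringHom_padicCoeffIntegers_padicComplexInt (Dm m).ι
  choose b hb using hb0
  letI : Algebra (UnrSeries p) (PowerSeries 𝓞_ℂ_[p]) := (PowerSeries.map (R1.unrToCpInt p)).toAlgebra
  have halg : algebraMap (UnrSeries p) (PowerSeries 𝓞_ℂ_[p]) = PowerSeries.map (R1.unrToCpInt p) := rfl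
  -- finite generation of `X^Σ_ac(A_{g_m})` over `Λ_{𝒪_m}`
  haveI : ∀ m : ℕ, Module.Finite (PowerSeries (padicCoeffIntegers (Dm m).ι))
      (XBig κ ((Dm m).Δ.selfDualCofreeRepOver K) 𝔭bar (↑(W.sigmaPlacesFinset p K) : Set (HeightOneSpectrum (𝓞 K)))) :=
    fun m =>
      haveI := (Dm m).finiteDimensional_padicCoeffField
      SkinnerUrban2014.moduleFinite_XBig_of_lemma319 SkinnerUrban2014.lemma319_finite_XBig_holds κ 𝔭bar _ hSfin
        ((Dm m).Δ.selfDualCofreeRepOver K)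
        (GreenbergSelmer.Cofree.exists_pow_psmul_eq_zero (Dm m).ι (Dm m).Δ.selfDualRep)
        (GreenbergSelmer.Cofree.divisible (padicCoeffField (Dm m).ι) (Dm m).Δ.selfDualRep (Fact.out : p.Prime).ne_zero)
        (GreenbergSelmer.Cofree.finite_setOf_psmul_eq_zero (Dm m).ι (Dm m).Δ.selfDualRep)
        (SelfDualTwist.selfDualCofreeRepOver_localMap_inr_apply_eq_self (Dm m).Δ K _ hSM)
  -- ### the member congruences `e_m` at `3 ≤ p`
  have hEm : ∀ m : ℕ, 1 ≤ m →
      Nonempty ((((PowerSeries (padicCoeffIntegers (Dm m).ι)) ⊗[IwasawaAlgebra p]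
            AcSelmer.XAc (W.baseChange K) p κ 𝔭bar (↑(W.sigmaPlacesFinset p K) : Set (HeightOneSpectrum (𝓞 K))) γ) ⧸
          (((Ideal.span {(C (p : ℤ_[p]) : IwasawaAlgebra p)}).map
              (algebraMap (IwasawaAlgebra p) (PowerSeries (padicCoeffIntegers (Dm m).ι)))) ^ m •
            (⊤ : Submodule (PowerSeries (padicCoeffIntegers (Dm m).ι))
              ((PowerSeries (padicCoeffIntegers (Dm m).ι)) ⊗[IwasawaAlgebra p]
                AcSelmer.XAc (W.baseChange K) p κ 𝔭bar (↑(W.sigmaPlacesFinset p K) : Set (HeightOneSpectrum (𝓞 K))) γ))))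
          ≃ₗ[PowerSeries (padicCoeffIntegers (Dm m).ι)]
        (XBig κ ((Dm m).Δ.selfDualCofreeRepOver K) 𝔭bar (↑(W.sigmaPlacesFinset p K) : Set (HeightOneSpectrum (𝓞 K))) ⧸
          (((Ideal.span {(C (p : ℤ_[p]) : IwasawaAlgebra p)}).map
              (algebraMap (IwasawaAlgebra p) (PowerSeries (padicCoeffIntegers (Dm m).ι)))) ^ m •
            (⊤ : Submodule (PowerSeries (padicCoeffIntegers (Dm m).ι))
              (XBig κ ((Dm m).Δ.selfDualCofreeRepOver K) 𝔭bar (↑(W.sigmaPlacesFinset p K) : Set (HeightOneSpectrum (𝓞 K)))))))) := by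
    intro m hm
    exact nonempty_quotPow_congr_of_eq _ (max_eq_left hm)
      (SelfDual.nonempty_memberCongruence_odd_of_facts hSh Skinner2016.selmerBig_extendScalars_equiv_baseChange_holds hp
        hirr hK hHp 𝔭bar h𝔭bar φ hiv _ hSfin hSp hS hSM κ hκ γ (Dm m) (le_max_right m 1) (hDm m).1).some
  -- ### `μ(L) = 0` and the finite-`μ` split of `P_Σ`: the descent runs against `L·P′`, `P_Σ = p^t·P′`, `p ∤ L·P′`
  haveI := HidaLimitAlgebra.isNoetherianRing_unrSeries (p := p)
  have hprime : Prime (C ((p : ℕ) : unrIntegers p) : UnrSeries p) :=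
    prime_C_of_prime CongruenceDescent.prime_natCast_p_unrIntegers
  have hPS0 : PowerSeries.map (toUnr p) (W.sigmaEulerElement p K κ) ≠ 0 := fun h ↦
    W.sigmaEulerElement_ne_zero p K κ (map_toUnr_injective (by rw [h, map_zero]))
  haveI : WfDvdMonoid (UnrSeries p) := IsNoetherianRing.wfDvdMonoid
  obtain ⟨t, P', hP', hfac⟩ := WfDvdMonoid.max_power_factor hPS0 hprime.irreducible
  have hL : ¬ (C ((p : ℕ) : unrIntegers p) : UnrSeries p) ∣ L :=
    RoadFFSaturation.not_C_dvd_of_exists_isUnit_coeff hμL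
  have hLP' : ¬ (C ((p : ℕ) : unrIntegers p) : UnrSeries p) ∣ L * P' := fun h ↦
    (hprime.dvd_or_dvd h).elim hL hP'
  have hav := Halves.avoid_of_not_C_dvd hLP'
  obtain ⟨s, V, Q', hV, hshape⟩ :=
    RoadFFSaturation.exists_shape_of_isUnit_coeff (RoadFFSaturation.exists_isUnit_coeff_of_not_C_dvd hLP')
  have hM : L * PowerSeries.map (toUnr p) (W.sigmaEulerElement p K κ) = C ((p : ℕ) : unrIntegers p) ^ t * (L * P') := by
    rw [hfac]; ring
  -- the same data read in `𝓞_{ℂ_p}⟦T⟧`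
  have hp0 : ((p : ℕ) : 𝓞_ℂ_[p]) ≠ 0 := by
    intro h
    have h' := congrArg (fun z : 𝓞_ℂ_[p] ↦ (z : ℂ_[p])) h
    simp only [SubringClass.coe_natCast, ZeroMemClass.coe_zero] at h'
    exact (Nat.cast_ne_zero.mpr (Fact.out : p.Prime).ne_zero) h'
  have hreg : ∀ z : 𝓞_ℂ_[p], ((p : ℕ) : 𝓞_ℂ_[p]) * z = 0 → z = 0 := fun z hz ↦
    (mul_eq_zero.mp hz).resolve_left hp0
  have hpnu : ¬ IsUnit ((p : ℕ) : 𝓞_ℂ_[p]) := by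
    rintro ⟨u, hu⟩
    have h1 := R1.norm_coe_units_padicComplexInt p u
    rw [hu, SubringClass.coe_natCast, Literature.NumberTheory.LFunctions.Dwork.norm_natCast_p_padicComplex] at h1
    have h1p : (1 : ℝ) < p := by exact_mod_cast (Fact.out : p.Prime).one_lt
    exact absurd h1 (ne_of_lt (inv_lt_one_of_one_lt₀ h1p))
  have hJac : ∀ h : 𝓞_ℂ_[p], IsUnit (1 - ((p : ℕ) : 𝓞_ℂ_[p]) * h) := fun h ↦
    IsLocalRing.isUnit_one_sub_self_of_mem_nonunits _
      (mem_nonunits_iff.mpr fun hu ↦ hpnu (isUnit_of_mul_isUnit_left hu))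
  have hMa : PowerSeries.map (R1.unrToCpInt p) (L * PowerSeries.map (toUnr p) (W.sigmaEulerElement p K κ)) =
      C ((p : ℕ) : 𝓞_ℂ_[p]) ^ t * PowerSeries.map (R1.unrToCpInt p) (L * P') := by
    rw [hM, map_mul, map_pow, map_C, map_natCast]
  have hshape' : PowerSeries.map (R1.unrToCpInt p) (L * P') =
      X ^ s * PowerSeries.map (R1.unrToCpInt p) V + C ((p : ℕ) : 𝓞_ℂ_[p]) * PowerSeries.map (R1.unrToCpInt p) Q' := by
    rw [hshape, map_add, map_mul, map_mul, map_pow, map_X, map_C, map_natCast]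
  -- ### (c) ⟹ unit congruence at every level `m > t` (`1 ≤ m`, so the member is the one at `max m 1 = m`)
  have hunit : ∀ m : ℕ, 1 ≤ m → t < m → ∃ u G : PowerSeries 𝓞_ℂ_[p], IsUnit u ∧
      Qm m = u * (C ((p : ℕ) : 𝓞_ℂ_[p]) ^ t * PowerSeries.map (R1.unrToCpInt p) (L * P')) +
        C ((p : ℕ) : 𝓞_ℂ_[p]) ^ m * G := by
    intro m hm htm
    have hc := (hDm m).2.2
    rw [max_eq_left hm, map_pow, hMa] at hc
    exact RoadFFSaturation.exists_unit_congruence_of_span_sup_eq hreg hJac t s m htm (hV.map _) rfl hshape' hc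
  -- ### per level above `t`: the member inclusion with exponent `t` (saturation, p628881) and (c) one-sided
  have hK1t : ∀ m : ℕ, 1 ≤ m → t < m →
      Module.IsTorsion (PowerSeries (padicCoeffIntegers (Dm m).ι))
          (XBig κ ((Dm m).Δ.selfDualCofreeRepOver K) 𝔭bar (↑(W.sigmaPlacesFinset p K) : Set (HeightOneSpectrum (𝓞 K)))) →
        Ideal.span {(C ((p : ℕ) : 𝓞_ℂ_[p]) : PowerSeries 𝓞_ℂ_[p]) ^ t} *
            (XBig.charIdeal κ ((Dm m).Δ.selfDualCofreeRepOver K) 𝔭bar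
              (↑(W.sigmaPlacesFinset p K) : Set (HeightOneSpectrum (𝓞 K)))).map (PowerSeries.map (b m)) ≤
          Ideal.span {Qm m} := by
    intro m hm htm hTm
    obtain ⟨u, G, hu, hQm⟩ := hunit m hm htm
    obtain ⟨e, he⟩ := (hDm m).2.1 (b m) (hb m) hTm
    exact RoadFFSaturation.span_pow_mul_le_of_unitCong hreg hu (hV.map _) s t m e htm hshape' hQm _ he
  have hcQ : ∀ m : ℕ, 1 ≤ m → t < m →
      Qm m ∈ Ideal.span {PowerSeries.map (R1.unrToCpInt p) (L * P')} ⊔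
        Ideal.span {(C ((p : ℕ) : 𝓞_ℂ_[p]) : PowerSeries 𝓞_ℂ_[p]) ^ m} := by
    intro m hm htm
    obtain ⟨u, G, _, hQm⟩ := hunit m hm htm
    rw [hQm]
    exact Ideal.add_mem _
      (Ideal.mem_sup_left (Ideal.mem_span_singleton'.mpr ⟨u * C ((p : ℕ) : 𝓞_ℂ_[p]) ^ t, by ring⟩))
      (Ideal.mem_sup_right (Ideal.mul_mem_right _ _ (Ideal.mem_span_singleton_self _)))
  -- ### the coefficient squares `Λ → 𝒪_m⟦T⟧ →(map b_m) 𝓞_{ℂ_p}⟦T⟧ ← R₀⟦T⟧`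
  have hφ' : ∀ m : ℕ, (PowerSeries.map (b m)).comp
      (algebraMap (IwasawaAlgebra p) (PowerSeries (padicCoeffIntegers (Dm m).ι))) =
      (algebraMap (UnrSeries p) (PowerSeries 𝓞_ℂ_[p])).comp (PowerSeries.map (toUnr p)) := fun m ↦ by
    rw [halg]
    exact map_comp_algebraMap_eq_of_coe_eq (b m) (hb m)
  have htw : ∀ m : ℕ, (PowerSeries.map (b m))
      (algebraMap (IwasawaAlgebra p) (PowerSeries (padicCoeffIntegers (Dm m).ι))
        ((PowerSeries.C (p : ℤ_[p]) : IwasawaAlgebra p) ^ t)) = C ((p : ℕ) : 𝓞_ℂ_[p]) ^ t := by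
    intro m
    rw [← RingHom.comp_apply (PowerSeries.map (b m))
      (algebraMap (IwasawaAlgebra p) (PowerSeries (padicCoeffIntegers (Dm m).ι))), hφ' m, RingHom.comp_apply, halg,
      map_pow, map_pow, PowerSeries.map_C, map_natCast, PowerSeries.map_C, map_natCast]
  -- ### the second summand `((C p)Λ·R₀⟦T⟧·𝓞_{ℂ_p}⟦T⟧)^m = ((C p)^m)`; in `R₀⟦T⟧` it contains `C (p^m)`
  have h2nd : ∀ m : ℕ, (((Ideal.span {(C (p : ℤ_[p]) : IwasawaAlgebra p)}).map (PowerSeries.map (toUnr p))).map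
      (algebraMap (UnrSeries p) (PowerSeries 𝓞_ℂ_[p]))) ^ m = Ideal.span {C ((p : ℕ) : 𝓞_ℂ_[p]) ^ m} := by
    intro m
    rw [RoadFFMember.map_map_span_C_natCast_pow, ← map_natCast (C : 𝓞_ℂ_[p] →+* PowerSeries 𝓞_ℂ_[p]) p]
  have hR2nd : ∀ m : ℕ, ((Ideal.span {(C (p : ℤ_[p]) : IwasawaAlgebra p)}).map (PowerSeries.map (toUnr p))) ^ m =
      Ideal.span {(C ((p : ℕ) : unrIntegers p) : UnrSeries p) ^ m} := by
    intro m
    rw [Ideal.map_span, Set.image_singleton, PowerSeries.map_C, map_natCast, Ideal.span_singleton_pow]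
  -- ### the UNTWISTED Fitting-level member limit against `L·P′`, descent by purity
  have key : (Module.fittingIdeal (IwasawaAlgebra p)
      (AcSelmer.XAc (W.baseChange K) p κ 𝔭bar (↑(W.sigmaPlacesFinset p K) : Set (HeightOneSpectrum (𝓞 K))) γ) 0).map
        (PowerSeries.map (toUnr p)) ≤ Ideal.span {L * P'} := by
    refine AcSelmer.XAc.map_fittingIdeal_le_span_of_oneSided_congruences_le_printed_perLevel_of_desc
      (W.baseChange K) p κ 𝔭bar γ hSfin (fun _ => t) (fun n => ⟨t + n + 1, by omega, by omega⟩) (L * P') hav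
      (fun m => PowerSeries (padicCoeffIntegers (Dm m).ι)) (fun _ => PowerSeries 𝓞_ℂ_[p])
      (fun m => PowerSeries.map (b m)) hφ'
      (fun m => XBig κ ((Dm m).Δ.selfDualCofreeRepOver K) 𝔭bar (↑(W.sigmaPlacesFinset p K) : Set (HeightOneSpectrum (𝓞 K))))
      (fun m => if t < m then Qm m else (C ((p : ℕ) : 𝓞_ℂ_[p]) : PowerSeries 𝓞_ℂ_[p]) ^ m)
      (fun m hm => (hEm m hm).some) ?_ ?_ ?_
    · -- (K1′) with exponent `t`
      intro m hm hTm
      rw [htw m]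
      by_cases htm : t < m
      · rw [if_pos htm]
        exact hK1t m hm htm hTm
      · rw [if_neg htm]
        exact Ideal.mul_le_right.trans (Ideal.span_singleton_le_span_singleton.mpr (pow_dvd_pow _ (not_lt.mp htm)))
    · -- (c), one-sided, against `L·P′`
      intro m hm
      rw [h2nd m, Ideal.span_singleton_le_iff_mem, halg]
      by_cases htm : t < m
      · rw [if_pos htm]
        exact hcQ m hm htm
      · rw [if_neg htm]
        exact Ideal.mem_sup_right (Ideal.mem_span_singleton_self _)
    · -- descent by PURITY of `R₀⟦T⟧ → 𝓞_{ℂ_p}⟦T⟧` for ideals containing `p^m`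
      intro m J' hJ'
      beta_reduce at hJ' ⊢
      have hmem : (PowerSeries.C (((p : ℕ) : unrIntegers p) ^ m) : UnrSeries p) ∈
          Ideal.span {L * P'} ⊔ ((Ideal.span {(C (p : ℤ_[p]) : IwasawaAlgebra p)}).map (PowerSeries.map (toUnr p))) ^ m := by
        rw [hR2nd m, map_pow]
        exact Ideal.mem_sup_right (Ideal.mem_span_singleton_self _)
      rw [halg] at hJ'
      exact (Ideal.map_le_iff_le_comap.mp hJ').trans (ReceptaclePurity.comap_map_unrToCpInt_eq_of_C_pow_mem _ hmem).le
  -- ### re-twist by `C(p)^t`: `(C(p)^t·Fitt)·R₀⟦T⟧ ⊆ (p̄^t·L·P′) = (L·P_Σ)`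
  refine ⟨t, ?_⟩
  rw [Ideal.map_mul, Ideal.map_span, Set.image_singleton, map_pow, PowerSeries.map_C, map_natCast]
  calc Ideal.span {(C ((p : ℕ) : unrIntegers p) : UnrSeries p) ^ t} *
        (Module.fittingIdeal (IwasawaAlgebra p)
          (AcSelmer.XAc (W.baseChange K) p κ 𝔭bar (↑(W.sigmaPlacesFinset p K) : Set (HeightOneSpectrum (𝓞 K))) γ) 0).map
          (PowerSeries.map (toUnr p))
      ≤ Ideal.span {(C ((p : ℕ) : unrIntegers p) : UnrSeries p) ^ t} * Ideal.span {L * P'} :=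
        Ideal.mul_mono_right key
    _ = Ideal.span {L * PowerSeries.map (toUnr p) (W.sigmaEulerElement p K κ)} := by
        rw [Ideal.span_singleton_mul_span_singleton, hfac]; ring_nf


/-! ### §3 At the 3-multiplicative twin: the Wan clause UNDER torsion from members read in `𝓞_{ℂ₃}⟦T⟧` -/

/-- **SELF-DUAL MEMBERS WITH `𝓞_{ℂ₃}⟦T⟧`-FRAMES (weights `k_m ≡ 2 (mod 4·3^{m−1})`, rational inclusion of ANY exponent, printed
congruence) + TORSION + `μ(L) = 0` ⟹ THE RATIONAL WAN CLAUSE AT THE GIVEN FRAME (♭B′'s consequent).** Under the binders of ♭B′ ∕ line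
`membertower` plus (dec) `W′(ℚ₃)[3] = 0`: `L ∈ R₀⟦T⟧` with a unit coefficient, for every `m ≥ 1` a Hida member `g_m` with
`2·(3−1)·3^{m−1} ∣ k_m − 2` and SOME `Q_m ∈ 𝓞_{ℂ₃}⟦T⟧` such that (K1′†) «torsion → `(3^e)·Ch(X^Σ_ac(A^†_{g_m}))·𝓞_{ℂ₃}⟦T⟧ ⊆ (Q_m)` for SOME
`e`» (self-dual module `D.Δ.selfDualCofreeRepOver K`) and (c) `(Q_m) + (3^m) = (L·P_Σ) + (3^m)`, and Λ-torsion of `X^∅_ac(W′/K_∞; slot 𝔭′)`: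
SOME `k` has `C(3^k)·G ∈ (L)` for every `G ∈ Ch_Λ(X^∅)·R₀⟦T⟧`. §2† + p613967 + p612782's twisted recombination, as p633686 §3.
CONDITIONAL on Shapiro `hSh` (PUBLISHED), the member data (RESEARCH, port-shaped), torsion and (dec); nothing is booked; BSD is proved
for no curve. [cite: Skinner2016PacificMC, §3.1 (p. 192)] [cite: Hsieh2014, Thm. B] [cite: JetchevSkinnerWan2017, §5.1]
[cite: Castella2018Erratum, §2 (p. 2) and proof of Thm. 1.1 (c) (p. 4)] -/
theorem twin_exists_forall_C_pow_mul_mem_span_of_cpIntMemberTower_selfDual_of_isTorsion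
    (hSh : SkinnerUrban2014.prop323_XAc_equiv_XBigDecomp)
    (W' : WeierstrassCurve ℚ) [W'.IsElliptic] [W'.IsGloballyMinimal] (N' : ℕ)
    (K : Type) [Field K] [NumberField K]
    (hm : Mult W' 3) (hsurj : W'.HasSurjectiveModNGaloisRep 3) (hN : W'.conductorNorm ℤ = N')
    (hK : IsImaginaryQuadratic K) (hH : SatisfiesHeegnerHypothesis N' K)
    (κ : ZpExtension K 3) (hκ : κ.IsAnticyclotomic) (γ : Field.absoluteGaloisGroup K) [Fact (κ.IsTopGenerator γ)]
    (𝔭' : HeightOneSpectrum (𝓞 K)) (h𝔭' : ((3 : ℕ) : 𝓞 K) ∈ 𝔭'.asIdeal)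
    (hiv : ∀ Q : (W'.baseChange ℚ_[3]).toAffine.Point, 3 • Q = 0 → Q = 0)
    (hT₀ : Module.IsTorsion (IwasawaAlgebra 3) (AcSelmer.XAc (W'.baseChange K) 3 κ 𝔭' ∅ γ))
    (L : UnrSeries 3) (hμL : ∃ i : ℕ, IsUnit (PowerSeries.coeff i L))
    (hmem : ∀ m : ℕ, 1 ≤ m →
      ∃ (D : Skinner2016.HidaCongruentMember W' 3 m) (Qm : PowerSeries 𝓞_ℂ_[3]),
        (2 * ((3 : ℤ) - 1) * (3 : ℤ) ^ (m - 1)) ∣ D.k - 2 ∧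
        (∀ [TopologicalSpace (PowerSeries (padicCoeffIntegers D.ι))]
          [ContinuousSMul (PowerSeries (padicCoeffIntegers D.ι))
            (BigRepModule (padicCoeffIntegers D.ι) 3 (Cofree D.Δ.selfDualRep (padicCoeffField D.ι)))],
          ∀ (b : padicCoeffIntegers D.ι →+* 𝓞_ℂ_[3]),
            (∀ x, ((b x : 𝓞_ℂ_[3]) : ℂ_[3]) = algebraMap (PadicAlgCl 3) ℂ_[3] (padicCoeffIntegers.toPadicAlgCl D.ι x)) →
            Module.IsTorsion (PowerSeries (padicCoeffIntegers D.ι))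
                (XBig κ (D.Δ.selfDualCofreeRepOver K) 𝔭' (↑(W'.sigmaPlacesFinset 3 K))) →
              ∃ e : ℕ, Ideal.span {(C ((3 : ℕ) : 𝓞_ℂ_[3]) : PowerSeries 𝓞_ℂ_[3]) ^ e} *
                  (XBig.charIdeal κ (D.Δ.selfDualCofreeRepOver K) 𝔭' (↑(W'.sigmaPlacesFinset 3 K))).map (PowerSeries.map b) ≤
                Ideal.span {Qm}) ∧
        Ideal.span {Qm} ⊔ Ideal.span {(C (((3 : ℕ) : 𝓞_ℂ_[3]) ^ m) : PowerSeries 𝓞_ℂ_[3])} =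
          Ideal.span {PowerSeries.map (R1.unrToCpInt 3) (L * PowerSeries.map (toUnr 3) (W'.sigmaEulerElement 3 K κ))} ⊔
            Ideal.span {(C (((3 : ℕ) : 𝓞_ℂ_[3]) ^ m) : PowerSeries 𝓞_ℂ_[3])}) :
    ∃ k : ℕ, ∀ G ∈ (AcSelmer.XAc.charIdeal (W'.baseChange K) 3 κ 𝔭' ∅ γ).map (PowerSeries.map (toUnr 3)),
      PowerSeries.C (((3 : ℕ) : unrIntegers 3) ^ k) * G ∈ Ideal.span {L} := by
  have hirr : Irr W' 3 := hasIrreducibleModPGaloisRep_of_hasSurjectiveModNGaloisRep W' 3 hsurj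
  have hsp : SplitsIn K 3 := hH 3 Nat.prime_three (hN ▸ dvd_conductorNorm_of_mult hm)
  obtain ⟨t, key⟩ := P2.RoadFF.exists_map_span_C_pow_mul_fittingIdeal_le_of_cpIntMemberTower_selfDual_odd hSh W' 3 le_rfl
    K hK hirr hm hsp hiv κ hκ γ 𝔭' h𝔭' L hμL hmem
  obtain ⟨hSfin, hT, hPS, hX⟩ :=
    UniversalToricDescentTwinTorsionRankOne.twin_sigmaDataAt_of_isTorsion_empty' W' N' K hm hN hK hH κ hκ γ 𝔭' h𝔭' hT₀
  exact ⟨t, AcSelmer.XAc.forall_C_pow_mul_mem_span_of_map_span_mul_fittingIdeal_le (W'.baseChange K) 3 κ 𝔭' γ hSfin hT t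
    key hPS hX (dvd_refl _)⟩

end Summit.BirchSwinnertonDyer.Rank1Residual.X11b

end
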